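import Literature.IUT.LogVolume.DHAvgDifferentBound
import Literature.IUT.HodgeTheaters.InitialThetaDataTorsionDegree
import Mathlib.NumberTheory.NumberField.Discriminant.Basic
import Mathlib.Analysis.Complex.ExponentialBounds
import HarnessLib

/-!
# Dupuy–Hilado (arXiv:2004.13108v2) Thm 1.0.4 = 7.13.1 (Baby Szpiro), the printed (7.17), at every genuine
# section datum and at an initial Θ-datum from (7.4) and the SINGLE floor `[K:ℚ] ≥ 6840`

PROOF-ONLY sequel of `DHAvgDifferentBound` / `DHBabySzpiroCorrected` / `DHFieldOfModuliBadRamified` (T. Dupuy,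
A. Hilado, arXiv:2004.13108v2 [DupuyHilado2020], UNREFEREED; held render `book:anonnd-2004-13108v2`, locators
`p.N l.M`). No new definition, no new `Prop` fact. Cited BY NAME: `Ineq74`, `BabySzpiroIneq`,
`BabySzpiroClaim`, `BabySzpiroThm`, `sectionRamificationOf`, `probabilisticSzpiro_corrected`,
`sum_log_avgRamIdx_le` ((7.19) PROVED), `sum_one_sub_probUnram_pow_mul_log_le` (replacement of (7.20)),
`eight_le_log_of_le`, `sectionRamificationOf_e_ne_one` (`bad ⇒ ramified` at `D`), `residueChar_liftPlace`,
`SectionRamification.lnAvgDifferent_ofLift_le` ((7.18)♯: `ln Diff ≤ ln rad D + ω(D)·ln d`, PROVED).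

## What is PROVED (Thm 7.13.1 p.28 l.65 – p.29 l.33; Thm 1.0.4 p.3 l.44–56)

Print's proof bounds the right side of (7.15) by (7.18) `ln(rad D·d)`, (7.19) `ln(d)·ω(D)`, (7.20) `ln D`,
then "`ω(N) ≤ ln(N)/ln2(N)`" (l.22) and "Since `D, d ≥ SL₂(𝔽_l) ≥ 6840`" (l.27), `D = |Disc(K/ℚ)|`,
`d = [K:ℚ]`. With (7.18) replaced by what the classical different bound gives unconditionally ((7.18)♯, one
more `ω(D)·ln d`), the printed display (7.17) still follows, from the floor on `d` alone:

* `le_natAbs_discr_of_le_finrank` — `[K:ℚ] ≥ 6840 ⇒ |Disc(K/ℚ)| ≥ 6840` (Minkowski, Mathlib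
  `NumberField.abs_discr_ge`: `|Disc| ≥ (4/9)(3π/4)^{[K:ℚ]}`), so print's floor needs only `d`;
* `card_primeFactors_le_two_thirds_log` — `ω(N) ≤ (2/3)·ln N` for `N ≥ 6840` (a set of `k` primes has
  product `≥ 2·3·5·7·9···(2k−1) ≥ e^{3k/2}` from `k = 6` on; `k ≤ 5 ≤ (2/3)·8` below);
* `babySzpiro_structural'` — `(1/(6+ε_l))·deĝ̲(𝔮) ≤ (ln rad D + ω(D) ln d) + ω(D) ln d + ln π + (4/(l+5)) ln rad D`
  from (7.4), `bad ⇒ ramified`;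
* `babySzpiro_of_ineq74` — **(7.17) = `BabySzpiroIneq X [K:ℚ] |Disc(K/ℚ)|` at every genuine datum from
  (7.4) (`Ineq74`, hypothesis), `bad ⇒ ramified` and `[K:ℚ] ≥ 6840` ALONE** (budget: `rad D ≤ D`,
  `ω(D) ≤ (2/3) ln D`, `4/(l+5) ≤ 2/5`, `(7/5) ln D + (4/3) ln d·ln D ≤ (25/16) ln d·ln D` for `ln d ≥ 8`)
  — so the template `BabySzpiroClaim` (`babySzpiroClaim_ofLift`, gen. 4) no longer needs its `BabySzpiroInputs`;
* `babySzpiroThm_of_le_finrank` — **Thm 1.0.4 at an initial Θ-datum `D` (the typed `BabySzpiroThm D T`,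
  conclusion (7.17) AS PRINTED) from `6840 ≤ [K:ℚ]` only**: the inputs `h18` ((7.18)) and `hD` of
  `babySzpiroThm_of_ineq718` are gone;
* `babySzpiroThm_of_nineteen_le` (appended) — **the same from `19 ≤ l` alone**: `6840 = |SL₂(𝔽_19)| ≤ [K:ℚ]`
  by [IUTchI] Def. 3.1 (c) (`InitialThetaData.le_finrank_rat_of_nineteen_le`,
  `Literature.IUT.HodgeTheaters.InitialThetaDataTorsionDegree`) — print's floor "`D, d ≥ SL₂(𝔽_l) ≥ 6840`"
  (p.29 l.27) read with its implicit `l ≥ 19`; no residual input remains besides it ((7.4) stays INSIDE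
  the template as its hypothesis).

HONEST FRAMING: (7.4) = `Ineq74` — the authors' reading of the DISPUTED [IUTchIII] Cor. 3.12
[claim: Mochizuki2012, status: disputed] + Claim 5.0.1 [claim: DupuyHilado2020, status: under-review] — is a
hypothesis (explicit, or internal to the templates) and is never asserted. What is proved is
`(7.4) ∧ [K:ℚ] ≥ 6840 ⟹ (7.17)` at genuine data, a theorem ABOUT the candidate templates. Print's floor
`6840 = |SL₂(𝔽_19)|` presumes `l ≥ 19`; it stays a hypothesis. Typed ≠ proved ≠ endorsed; no side is taken
on any author; no abc claim.
-/

noncomputable section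

namespace Literature.IUT.LogVolume

open NumberField IsDedekindDomain Finset Literature.NumberTheory.NumberFields

/-! ## Classical inputs: Minkowski's floor and `ω(N) ≤ (2/3)·ln N` -/
section Classical

variable (K : Type) [Field K] [NumberField K]


/-- **Minkowski's floor**: `[K:ℚ] ≥ 6840 ⇒ |Disc(K/ℚ)| ≥ 6840` (Mathlib `NumberField.abs_discr_ge`:
`|Disc| ≥ (4/9)(3π/4)^{[K:ℚ]} ≥ (4/9)·2^{14}`). Print's floor "Since `D, d ≥ SL₂(𝔽_l) ≥ 6840`" (p.29 l.27)
thus needs only the degree. [folklore] [cite: DupuyHilado2020, Thm 7.13.1 proof p.29 l.27] -/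
theorem le_natAbs_discr_of_le_finrank (h : 6840 ≤ Module.finrank ℚ K) :
    6840 ≤ (NumberField.discr K).natAbs := by
  have h1 : 1 < Module.finrank ℚ K := by omega
  have hM := NumberField.abs_discr_ge h1
  have hpi : (2 : ℝ) ≤ 3 * Real.pi / 4 := by nlinarith [Real.pi_gt_three]
  have hpow : (2 : ℝ) ^ Module.finrank ℚ K ≤ (3 * Real.pi / 4) ^ Module.finrank ℚ K :=
    pow_le_pow_left₀ (by norm_num) hpi _
  have h14 : (2 : ℝ) ^ 14 ≤ 2 ^ Module.finrank ℚ K := pow_le_pow_right₀ (by norm_num) (by omega)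
  norm_num at h14
  rw [Int.cast_abs] at hM
  have hR : (6840 : ℝ) ≤ ((NumberField.discr K).natAbs : ℝ) := by
    rw [Nat.cast_natAbs, Int.cast_abs]
    linarith
  exact_mod_cast hR

/-- In a finite set of primes all `≤ a` there are at most `(a+1)/2` elements (`q ↦ (q+1)/2` is injective on
primes into `[1, (a+1)/2]`); so `k` primes have maximum `≥ 2k − 1`. Elementary helper. [folklore] -/
private theorem two_mul_card_le_of_primes_le (s : Finset ℕ) (hs : ∀ q ∈ s, q.Prime) (a : ℕ)
    (ha : ∀ q ∈ s, q ≤ a) : 2 * s.card ≤ a + 1 := by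
  have hcard : s.card ≤ (Finset.Icc 1 ((a + 1) / 2)).card := by
    refine Finset.card_le_card_of_injOn (fun q => (q + 1) / 2) (fun q hq => ?_) (fun q hq q' hq' h => ?_)
    · have h2 := (hs q hq).two_le
      have hq' := ha q hq
      simp only [Finset.coe_Icc, Set.mem_Icc]
      omega
    · have h1 := (hs q hq).eq_two_or_odd'
      have h2 := (hs q' hq').eq_two_or_odd'
      have h3 := (hs q hq).two_le
      have h4 := (hs q' hq').two_le
      simp only at h
      rcases h1 with h1 | ⟨m, hm⟩ <;> rcases h2 with h2 | ⟨m', hm'⟩ <;> omega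
  rw [Nat.card_Icc] at hcard
  omega

/-- A finite non-empty set of primes with `k` elements has product `≥ 2·3·5·7·9···(2k−1)` (its largest element is
`≥ 2k − 1`). Elementary helper for `ω(N) ≤ (2/3) ln N`. [folklore] -/
private theorem two_mul_prod_odd_le_prod_primes (s : Finset ℕ) :
    (∀ q ∈ s, q.Prime) → s.Nonempty →
      2 * ∏ i ∈ Finset.range (s.card - 1), (2 * i + 3) ≤ ∏ q ∈ s, q := by
  refine Finset.induction_on_max s (fun _ h => absurd h Finset.not_nonempty_empty) ?_
  intro a s ha ih hs _
  have hnot : a ∉ s := fun h => lt_irrefl a (ha a h)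
  have hs' : ∀ q ∈ s, q.Prime := fun q hq => hs q (Finset.mem_insert_of_mem hq)
  have hap : a.Prime := hs a (Finset.mem_insert_self a s)
  rw [Finset.prod_insert hnot, Finset.card_insert_of_notMem hnot]
  rcases s.eq_empty_or_nonempty with hse | hne
  · subst hse
    simpa using hap.two_le
  · have hIH := ih hs' hne
    have hk : 1 ≤ s.card := Finset.card_pos.mpr hne
    have hmax : 2 * (s.card + 1) ≤ a + 1 := by
      have := two_mul_card_le_of_primes_le (insert a s) hs a (fun q hq => by
        rcases Finset.mem_insert.mp hq with rfl | hq
        · exact le_rfl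
        · exact (ha q hq).le)
      rwa [Finset.card_insert_of_notMem hnot] at this
    have hsplit : s.card + 1 - 1 = (s.card - 1) + 1 := by omega
    rw [hsplit, Finset.prod_range_succ]
    have h2 : 2 * (s.card - 1) + 3 ≤ a := by omega
    calc 2 * ((∏ i ∈ Finset.range (s.card - 1), (2 * i + 3)) * (2 * (s.card - 1) + 3))
        = (2 * (s.card - 1) + 3) * (2 * ∏ i ∈ Finset.range (s.card - 1), (2 * i + 3)) := by ring
      _ ≤ a * ∏ q ∈ s, q := Nat.mul_le_mul h2 hIH

/-- `e^{3k/2} ≤ 2·3·5·7·9···(2k−1)` for `k ≥ 6` (`e^9 < 8104 ≤ 20790`; each further factor `2k+1 ≥ 13 > e^{3/2}`).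
Elementary helper. [folklore] -/
private theorem exp_three_halves_mul_le_prod_odd (k : ℕ) (hk : 6 ≤ k) :
    Real.exp (3 * (k : ℝ) / 2) ≤ ((2 * ∏ i ∈ Finset.range (k - 1), (2 * i + 3) : ℕ) : ℝ) := by
  induction k, hk using Nat.le_induction with
  | base =>
    have h9 : Real.exp (3 * ((6 : ℕ) : ℝ) / 2) = Real.exp 1 ^ 9 := by
      rw [← Real.exp_nat_mul]; norm_num
    rw [h9]
    have hlt : Real.exp 1 ^ 9 < (2.7182818286 : ℝ) ^ 9 :=
      pow_lt_pow_left₀ Real.exp_one_lt_d9 (Real.exp_pos 1).le (by norm_num)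
    have hnum : ((2.7182818286 : ℝ) ^ 9) ≤ ((2 * ∏ i ∈ Finset.range (6 - 1), (2 * i + 3) : ℕ) : ℝ) := by
      norm_num [Finset.prod_range_succ]
    exact hlt.le.trans hnum
  | succ m hm ih =>
    have hsplit : m + 1 - 1 = (m - 1) + 1 := by omega
    have hexp : Real.exp (3 * ((m + 1 : ℕ) : ℝ) / 2) = Real.exp (3 * (m : ℝ) / 2) * Real.exp (3 / 2) := by
      rw [← Real.exp_add]; push_cast; ring_nf
    have h32 : Real.exp (3 / 2) ≤ (2 * ((m - 1 : ℕ) : ℝ) + 3) := by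
      have hle : Real.exp (3 / 2) ≤ Real.exp 1 ^ 2 := by
        rw [← Real.exp_nat_mul]
        exact Real.exp_le_exp.mpr (by norm_num)
      have hlt : Real.exp 1 ^ 2 < (2.7182818286 : ℝ) ^ 2 :=
        pow_lt_pow_left₀ Real.exp_one_lt_d9 (Real.exp_pos 1).le (by norm_num)
      have h13 : (13 : ℝ) ≤ 2 * ((m - 1 : ℕ) : ℝ) + 3 := by
        have : (5 : ℝ) ≤ ((m - 1 : ℕ) : ℝ) := by exact_mod_cast (show 5 ≤ m - 1 by omega)
        linarith
      nlinarith
    rw [hexp, hsplit, Finset.prod_range_succ]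
    push_cast
    have hpos : 0 ≤ ((2 * ∏ i ∈ Finset.range (m - 1), (2 * i + 3) : ℕ) : ℝ) := by positivity
    push_cast at ih hpos
    calc Real.exp (3 * (m : ℝ) / 2) * Real.exp (3 / 2)
        ≤ (2 * ∏ i ∈ Finset.range (m - 1), (2 * (i : ℝ) + 3)) * (2 * ((m - 1 : ℕ) : ℝ) + 3) :=
          mul_le_mul ih h32 (Real.exp_pos _).le hpos
      _ = 2 * ((∏ i ∈ Finset.range (m - 1), (2 * (i : ℝ) + 3)) * (2 * ((m - 1 : ℕ) : ℝ) + 3)) := by ring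

/-- **`ω(N) ≤ (2/3)·ln N` for `N ≥ 6840`** (`ω` = number of prime divisors, Mathlib `Nat.primeFactors`): the
form of print's "`ω(N) ≤ ln(N)/ln2(N)`" (p.29 l.22) that the second `ω(D)·ln d` of the unconditional (7.18)
needs. If `ω(N) ≤ 5` this is `5 ≤ (2/3)·8 ≤ (2/3) ln N`; if `ω(N) = k ≥ 6` then
`N ≥ rad N ≥ 2·3·5···(2k−1) ≥ e^{3k/2}`. [folklore] [cite: DupuyHilado2020, Thm 7.13.1 proof p.29 l.22–27] -/
theorem card_primeFactors_le_two_thirds_log (N : ℕ) (hN : 6840 ≤ N) :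
    (N.primeFactors.card : ℝ) ≤ 2 / 3 * Real.log N := by
  have hN0 : N ≠ 0 := by omega
  have hNR : (6840 : ℝ) ≤ N := by exact_mod_cast hN
  have h8 : 8 ≤ Real.log N := ExplicitSzpiro.eight_le_log_of_le hNR
  by_cases hk : N.primeFactors.card ≤ 5
  · have : (N.primeFactors.card : ℝ) ≤ 5 := by exact_mod_cast hk
    linarith
  · rw [not_le] at hk
    have hprimes : ∀ q ∈ N.primeFactors, q.Prime := fun q hq => Nat.prime_of_mem_primeFactors hq
    have hne : N.primeFactors.Nonempty := Finset.card_pos.mp (by omega)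
    have h1 := two_mul_prod_odd_le_prod_primes N.primeFactors hprimes hne
    have h2 : ∏ q ∈ N.primeFactors, q ≤ N := Nat.le_of_dvd (Nat.pos_of_ne_zero hN0) (Nat.prod_primeFactors_dvd N)
    have h3 := exp_three_halves_mul_le_prod_odd N.primeFactors.card (by omega)
    have h4 : Real.exp (3 * (N.primeFactors.card : ℝ) / 2) ≤ N :=
      h3.trans (by exact_mod_cast h1.trans h2)
    have h5 : 3 * (N.primeFactors.card : ℝ) / 2 ≤ Real.log N := by
      rw [Real.le_log_iff_exp_le (by positivity)]
      exact h4
    linarith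

end Classical

namespace ExplicitSzpiro

variable {F₀ : Type} [Field F₀] [NumberField F₀]

section OfLift

variable (K : Type) [Field K] [NumberField K] (lift : HeightOneSpectrum (𝓞 F₀) → HeightOneSpectrum (𝓞 K))

/-! ## Thm 7.13.1 (Baby Szpiro) at the genuine datum from (7.4) and `[K:ℚ] ≥ 6840` alone -/

variable (X : PilotData F₀)

/-- **Baby Szpiro, structural form without (7.18) as an input**: from (7.4) (`Ineq74`, hypothesis),
`bad ⇒ ramified`, `T` primes ⊇ residue characteristics of `S`:
`(1/(6+ε_l))·deĝ̲(𝔮) ≤ (ln rad D + ω(D)·ln d) + ω(D)·ln d + (ln π + (4/(l+5))·ln rad D)`, `d = [K:ℚ]`,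
`D = |Disc(K/ℚ)|` — `probabilisticSzpiro_corrected` + `lnAvgDifferent_ofLift_le` + (7.19)
`sum_log_avgRamIdx_le` + `sum_one_sub_probUnram_pow_mul_log_le`. [cite: DupuyHilado2020, Thm 7.13.1 proof p.29 l.1–26] -/
theorem babySzpiro_structural' (hlift : ∀ v, residueChar K (lift v) = residueChar F₀ v)
    (T : Finset ℕ) (hT : ∀ p ∈ T, p.Prime) (hS : ∀ v ∈ X.S, residueChar F₀ v ∈ T)
    (hNOS : ∀ v ∈ X.S, (SectionRamification.ofLift K lift).e v ≠ 1)
    (h74 : Ineq74 X (SectionRamification.ofLift K lift) T) :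
    (1 / (6 + epsProb X.l)) * FinDivisor.ndeg F₀ X.qDivisor ≤
      (Real.log (∏ p ∈ (NumberField.discr K).natAbs.primeFactors, (p : ℝ))
          + ((NumberField.discr K).natAbs.primeFactors.card : ℝ) * Real.log (Module.finrank ℚ K))
        + ((NumberField.discr K).natAbs.primeFactors.card : ℝ) * Real.log (Module.finrank ℚ K)
        + (Real.log Real.pi + (4 / ((X.l : ℝ) + 5)) *
            Real.log (∏ p ∈ (NumberField.discr K).natAbs.primeFactors, (p : ℝ))) := by
  have key := probabilisticSzpiro_corrected X (SectionRamification.ofLift K lift) T hT hS hNOS h74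
  have h18 := SectionRamification.lnAvgDifferent_ofLift_le K lift hlift T hT
  have hA := sum_log_avgRamIdx_le K lift hlift T hT
  have hB := sum_one_sub_probUnram_pow_mul_log_le K lift hlift T hT (X.lstar + 1)
  have hrad : ∑ p ∈ (NumberField.discr K).natAbs.primeFactors, Real.log p =
      Real.log (∏ p ∈ (NumberField.discr K).natAbs.primeFactors, (p : ℝ)) := by
    rw [Real.log_prod]
    exact fun p hp => by exact_mod_cast (Nat.prime_of_mem_primeFactors hp).ne_zero
  rw [hrad] at hB
  have hB' := mul_le_mul_of_nonneg_left hB (by positivity : (0 : ℝ) ≤ 4 / ((X.l : ℝ) + 5))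
  linarith

/-- **Theorem 7.13.1 = Theorem 1.0.4 (Baby Szpiro), the printed display (7.17) PROVED at the genuine datum
from (7.4), `bad ⇒ ramified` and the floor `[K:ℚ] ≥ 6840` ALONE** (no (7.18)/(7.19)/(7.20) input, no
`|Disc| ≥ 6840`): `Ineq74 ⟹ (1/(6+ε_l))·deĝ̲(𝔮) ≤ ln([K:ℚ]^{5/4})·ln(|Disc(K/ℚ)|^{5/4}) + ln(π)` =
`BabySzpiroIneq X [K:ℚ] |Disc(K/ℚ)|`. Budget: `rad D ≤ D`, `ω(D) ≤ (2/3)·ln D`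
(`card_primeFactors_le_two_thirds_log`, `D ≥ 6840` by Minkowski), `4/(l+5) ≤ 2/5`, and
`(7/5)·ln D + (4/3)·ln d·ln D ≤ (25/16)·ln d·ln D` for `ln d ≥ 8`.
[cite: DupuyHilado2020, Thm 7.13.1 (7.17) p.28 l.65 – p.29 l.33] -/
theorem babySzpiro_of_ineq74 (hlift : ∀ v, residueChar K (lift v) = residueChar F₀ v)
    (T : Finset ℕ) (hT : ∀ p ∈ T, p.Prime) (hS : ∀ v ∈ X.S, residueChar F₀ v ∈ T)
    (hNOS : ∀ v ∈ X.S, (SectionRamification.ofLift K lift).e v ≠ 1)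
    (hd : 6840 ≤ Module.finrank ℚ K) (h74 : Ineq74 X (SectionRamification.ofLift K lift) T) :
    BabySzpiroIneq X (Module.finrank ℚ K) (NumberField.discr K).natAbs := by
  have key := babySzpiro_structural' K lift X hlift T hT hS hNOS h74
  have hD := le_natAbs_discr_of_le_finrank K hd
  unfold BabySzpiroIneq
  set d : ℝ := (Module.finrank ℚ K : ℝ) with hd_def
  set D : ℝ := (((NumberField.discr K).natAbs : ℕ) : ℝ) with hD_def
  set r : ℝ := ∏ p ∈ (NumberField.discr K).natAbs.primeFactors, (p : ℝ) with hr_def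
  set ω : ℝ := (((NumberField.discr K).natAbs.primeFactors.card : ℕ) : ℝ) with hω_def
  have hD0 : (NumberField.discr K).natAbs ≠ 0 := Int.natAbs_ne_zero.mpr (NumberField.discr_ne_zero K)
  have hdR : (6840 : ℝ) ≤ d := by rw [hd_def]; exact_mod_cast hd
  have hDR : (6840 : ℝ) ≤ D := by rw [hD_def]; exact_mod_cast hD
  have hdpos : 0 < d := by linarith
  have hr1 : 1 ≤ r := by
    rw [hr_def, ← Nat.cast_one, ← Nat.cast_prod, Nat.cast_le]
    exact Nat.one_le_iff_ne_zero.mpr (Finset.prod_ne_zero_iff.mpr fun p hp =>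
      (Nat.prime_of_mem_primeFactors hp).ne_zero)
  have hrD : r ≤ D := by
    rw [hr_def, hD_def, ← Nat.cast_prod, Nat.cast_le]
    exact Nat.le_of_dvd (Nat.pos_of_ne_zero hD0) (Nat.prod_primeFactors_dvd _)
  have hrpos : 0 < r := by linarith
  have hDpos : 0 < D := by linarith
  have ha : 8 ≤ Real.log d := eight_le_log_of_le hdR
  have hb : 8 ≤ Real.log D := eight_le_log_of_le hDR
  have hlogrD : Real.log r ≤ Real.log D := Real.log_le_log hrpos hrD
  have hω : ω ≤ 2 / 3 * Real.log D := by
    rw [hω_def, hD_def]; exact card_primeFactors_le_two_thirds_log _ hD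
  have hl : (4 : ℝ) / ((X.l : ℝ) + 5) ≤ 2 / 5 := by
    have h5 : (5 : ℝ) ≤ X.l := by exact_mod_cast X.five_le_l
    rw [div_le_div_iff₀ (by positivity) (by norm_num)]
    linarith
  have h54d : Real.log (d ^ ((5 : ℝ) / 4)) = (5 / 4) * Real.log d := Real.log_rpow hdpos _
  have h54D : Real.log (D ^ ((5 : ℝ) / 4)) = (5 / 4) * Real.log D := Real.log_rpow hDpos _
  rw [h54d, h54D]
  have hωa : ω * Real.log d ≤ 2 / 3 * (Real.log d * Real.log D) := by
    have := mul_le_mul_of_nonneg_right hω (by linarith : (0 : ℝ) ≤ Real.log d)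
    linarith [this, mul_comm (Real.log d) (Real.log D)]
  have h4r : (4 : ℝ) / ((X.l : ℝ) + 5) * Real.log r ≤ (2 / 5) * Real.log D :=
    mul_le_mul hl hlogrD (Real.log_nonneg hr1) (by norm_num)
  have hab : 8 * Real.log D ≤ Real.log d * Real.log D := by nlinarith
  have hfin : 5 / 4 * Real.log d * (5 / 4 * Real.log D) = 25 / 16 * (Real.log d * Real.log D) := by ring
  rw [hfin]
  linarith

end OfLift

/-! ## At an initial Θ-datum `D`: Thm 1.0.4 from `6840 ≤ [K:ℚ]` -/
section ThetaData

open Literature.IUT.HodgeTheaters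

variable {F K Fbar : Type} [Field F] [NumberField F] [Field K] [NumberField K] [Algebra F K]
  [Field Fbar] [Algebra F Fbar] [Algebra K Fbar] [DecidableEq F] [DecidableEq Fbar]
  {E : WeierstrassCurve F} [E.IsElliptic] {l : ℕ}
  {Pb : BadPlacePredicates K} (D : InitialThetaData F K Fbar E l Pb)

/-- **Theorem 1.0.4 = 7.13.1 (Baby Szpiro) at `D` — the typed template `BabySzpiroThm D T`, conclusion (7.17)
AS PRINTED — from the single floor `6840 ≤ [K:ℚ]`** (print p.29 l.27 "Since `D, d ≥ SL₂(𝔽_l) ≥ 6840`",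
which presumes `l ≥ 19`): (7.18) is replaced by the proved (7.18)♯, `|Disc(K/ℚ)| ≥ 6840` follows by
Minkowski, `bad ⇒ ramified` is `sectionRamificationOf_e_ne_one`; (7.4) stays inside the template as its
hypothesis. [cite: DupuyHilado2020, Thm 1.0.4 p.3 l.44–56; Thm 7.13.1 p.28 l.65 – p.29 l.33] -/
theorem babySzpiroThm_of_le_finrank (T : Finset ℕ) (hd : 6840 ≤ Module.finrank ℚ K) :
    BabySzpiroThm D T :=
  fun _ hT hS h74 => babySzpiro_of_ineq74 K (ThetaData.liftPlace D) (ThetaData.pilotData D)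
    (residueChar_liftPlace D) T hT hS (sectionRamificationOf_e_ne_one D) hd h74

/-- **Theorem 1.0.4 = 7.13.1 (Baby Szpiro) at `D` from `l ≥ 19` ALONE** — the typed template
`BabySzpiroThm D T` (conclusion (7.17) AS PRINTED; (7.4) = `Ineq74` is its internal hypothesis): print's
floor "Since `D, d ≥ SL₂(𝔽_l) ≥ 6840`" (p.29 l.27) holds at every initial Θ-datum with `l ≥ 19` by
[IUTchI] Def. 3.1 (c) (`InitialThetaData.le_finrank_rat_of_nineteen_le`: `(l−1)l(l+1) ≤ [K:F] ≤ [K:ℚ]`)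
and Minkowski; (7.18)–(7.20) and `bad ⇒ ramified` are discharged as in `babySzpiroThm_of_le_finrank`.
[cite: DupuyHilado2020, Thm 1.0.4 p.3 l.44–56; Thm 7.13.1 p.28 l.65 – p.29 l.33]
[cite: Mochizuki2012, IUTchI Def. 3.1 (c) p. 62] -/
theorem babySzpiroThm_of_nineteen_le (T : Finset ℕ) (hl : 19 ≤ l) : BabySzpiroThm D T :=
  babySzpiroThm_of_le_finrank D T (D.le_finrank_rat_of_nineteen_le hl)

end ThetaData

end ExplicitSzpiro

end Literature.IUT.LogVolume

end
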